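import Mathlib
import Summits.ValiantsHypothesis.ValiantsHypothesis.Theorems.MatrixDescartes.Negative.MatrixDescartesFalseOfTropicalMonster

/-!
# `TropicalB` (stmt-ValiantsHypothesis-19771) — ISOTONE REGISTERS UNDER LATTICE CONSTRAINTS ARE ADDITIVE
# (monotone comparative statics: any number of registers, any min/max-closed coupling, no logarithm, no constant)

Helper file for the crux `Theses.KPlusLogSqLaw.TropicalB` (`--supports stmt-ValiantsHypothesis-19771 --as helper`; seat
val-sym-trop-p5 g6 of the cell `pub-symmetroid`, 2026-08-27).  HONEST FRAMING: a structure theorem about SUB-FAMILIES of the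
terms of an ARBITRARY dominance design, in the tree's vocabulary (`IsDominant`, `tropWeight`, `termSign` of
`…MatrixDescartesFalseOfTropicalMonster`).  It proves nothing about `TropicalB` in its window and bears on neither
`WeakLifting`, B, `MatrixDescartes` (stmt-ValiantsHypothesis-18050) nor VP ≠ VNP.

## Statement
REGISTERS `i < r`, each with linearly ordered states `Fin n`; a CONFIGURATION is `x : Fin r → Fin n`.  The feasible
configurations form an arbitrary family `P` CLOSED UNDER POINTWISE `min` AND `max` (a sublattice of `(Fin n)^r`): every system
of difference constraints `x j − x i ≤ c i j` is such a family (`diff_inf_closed` / `diff_sup_closed`) — comparability chains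
`x 0 < x 1 < ⋯ < x (r−1)` (`strictMono_inf_closed` / `…sup_closed`), windows, bands `|x i − x j| ≤ w`, crowns and cycles of
comparabilities.  Inside any design `(d, v, ε)` of format `(m, K)` take terms `τ x`, present and pairwise distinct on `P`, with
ADDITIVE weights `tropWeight d v θ (τ x) = θ·Σ_i s i (x i) − Σ_i A i (x i)` whose slope tables are ISOTONE in the state:
`a ≤ b → s i a ≤ s i b`.  THEN (`IsotoneRegisters.le_of_dominant`) two members dominant at slopes `θ₁ ≤ θ₂` are COMPARABLE,
`x ≤ y` pointwise — along increasing slope no register ever moves down — and hence (`IsotoneRegisters.card_dominant_le`)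
at most `r·(n − 1) + 1` members of the family are dominant (each at some integer slope, against ALL present terms): the
registers ADD, whatever the lattice coupling and whatever `r`.  Corollaries: `card_dominant_le_of_strictMono` (comparability
chains of any length), `card_dominant_le_of_diff` (any difference-constraint system).

## Proof (Topkis' monotone comparative statics on a lattice, three lines)
Abstract form `Lattice.le_of_unique_max`: on any lattice, for a min/max-closed `F`, MODULAR `S, A`
(`S(x ⊓ y) + S(x ⊔ y) = S x + S y`) with `S` isotone, if `x` is the unique maximiser of `θ₁·S − A` over `F` and `y` that of
`θ₂·S − A`, `θ₁ ≤ θ₂`, then `x ≤ y`: otherwise `u = x ⊓ y ≠ x` and `w = x ⊔ y ≠ y`, so `W₁ u < W₁ x` and `W₂ w < W₂ y`; by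
modularity `W₁ w − W₁ y = W₁ x − W₁ u > 0`, and `W_θ w − W_θ y = θ·(S w − S y) − (A w − A y)` is non-decreasing in `θ` because
`S w ≥ S y` — contradiction at `θ₂`.  Separable functions on a product of chains are modular (`sum_inf_add_sum_sup`); a chain
in `(Fin n)^r` has at most `r(n−1) + 1` elements (strictly increasing rank `x ↦ Σ_i x i`, `Lattice.card_le_of_unique_max`).

## Why this family (located reading; numbers, not adjectives)
* THE DICHOTOMY IT ANCHORS.  Without isotonicity the very same architecture is Carstensen-hard: a chain of `r` single-line
  registers with WEAK comparability `y₁ ≤ y₂ ≤ ⋯ ≤ y_r` over `L` positions is EXACTLY the parametric shortest-path problem of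
  the `(r+1) × L` directed grid `Υ_{r+1,L}` (monotone `s–t` paths; register `i` at position `y` = the upward step from row `i`
  to row `i+1` taken in column `y`, its line = the weight of that vertical edge; horizontal edge weights reduce to vertical ones
  by telescoping along the rows), and STRICT comparability over `L` positions is `Υ_{r+1,L−r+1}` after the shift `y_i ↦ y_i − i`.
  For the grids Gajjar–Radhakrishnan prove `≤ 5L` breakpoints on `Υ_{3,L}` (`r = 2`), `O(L·log^{r−2} L)` on `Υ_{r+1,L}` for
  fixed `r`, and `L^{Ω(log L)}` on `Υ_{L,L}` with bit-length `O(log³ L)` [Gajjar–Radhakrishnan, «Parametric shortest paths in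
  planar graphs», ECCC TR18-211 (2018/19): Thm 51, Thm 53, Cor. 3].  So the conjecture «chains are linear, ≤ C·(Σ N_i)·L» of the
  seat memo LINEAR-COMPARABILITY.md §0 (val-sym-trop-p5 g5) is FALSE for long chains (`r ≍ L`) and open by one logarithm at
  `r = 3`, while the present file shows that ISOTONICITY of the slope tables is exactly what restores additivity, for every `r`
  and every lattice coupling.  The kernel neighbours: p476777 `ComparabilitySum.card_dominant_le` (`(N+U)·L·(⌊log₂L⌋+1)`, general
  slopes, `r = 2`), p487811 `ComparabilityLinear.card_dominant_le_linear` (`(3(N+U)+1)·L`, general slopes, `r = 2`).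
* PLANAR SUPPORTS (reading, not formalised).  For a planar bipartite support the perfect matchings are the integer points of
  a distributive lattice of height functions on the faces (Propp; Thurston), the weight is modular and its slope is
  `Σ_f S_f·h_f` with `S_f` the alternating sum of the class exponents around the face `f`; `Lattice.le_of_unique_max` is then
  the statement that designs with all `S_f ≥ 0` have NESTED optimal height functions along increasing slope, hence at most
  `Σ_f (height range of f) + 1` dominant terms — the Gallo–Grigoriadis–Tarjan monotone parametric min-cut phenomenon.
* WHAT IT IS NOT.  The cell's interval registers (two-pivot / three-pivot families) are MIXED-TONE (slope isotone in the
  right end of the cycle, antitone in the left end, and the constraint `b < a'` couples the two), so they are NOT in this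
  sector — they are governed by p476777 / p487811 / p490294 and, for long chains, by the grid dichotomy above.  Not a bound
  on designs (terms outside the family are not counted); not a statement about `K`.

[folklore] Topkis, «Minimizing a submodular function on a lattice», Oper. Res. 26 (1978) (monotone comparative statics);
Gallo–Grigoriadis–Tarjan, SIAM J. Comput. 18 (1989) (nested parametric min cuts).
-/

set_option linter.dupNamespace false
set_option autoImplicit false

namespace Summit.ValiantsHypothesis.ValiantsHypothesis.Theorems.KPlusLogSqLaw.IsotoneRegisters

open Summit.ValiantsHypothesis.ValiantsHypothesis.Theorems.MatrixDescartes.Negative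
open Finset

/-! ## 1. Abstract form: monotone comparative statics on a lattice (Topkis) -/

section AbstractLattice

variable {α : Type*} [Lattice α]

/-- **Topkis' monotone comparative statics, unique-optimum form.**  `F` is closed under `⊓` and `⊔`; `S, A : α → ℤ` are
MODULAR on `F` and `S` is isotone on `F`.  If `x ∈ F` is the unique maximiser of `θ₁·S − A` over `F` and `y ∈ F` the unique
maximiser of `θ₂·S − A` over `F` with `θ₁ ≤ θ₂`, then `x ≤ y`. [folklore: Topkis 1978] -/
theorem Lattice.le_of_unique_max {F : Set α}
    (hinf : ∀ x ∈ F, ∀ y ∈ F, x ⊓ y ∈ F) (hsup : ∀ x ∈ F, ∀ y ∈ F, x ⊔ y ∈ F)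
    (S A : α → ℤ)
    (hS : ∀ x ∈ F, ∀ y ∈ F, S (x ⊓ y) + S (x ⊔ y) = S x + S y)
    (hA : ∀ x ∈ F, ∀ y ∈ F, A (x ⊓ y) + A (x ⊔ y) = A x + A y)
    (hmono : ∀ x ∈ F, ∀ y ∈ F, x ≤ y → S x ≤ S y)
    {θ₁ θ₂ : ℤ} (hθ : θ₁ ≤ θ₂) {x y : α} (hx : x ∈ F) (hy : y ∈ F)
    (hx1 : ∀ z ∈ F, z ≠ x → θ₁ * S z - A z < θ₁ * S x - A x)
    (hy2 : ∀ z ∈ F, z ≠ y → θ₂ * S z - A z < θ₂ * S y - A y) : x ≤ y := by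
  by_contra hxy
  have hu : x ⊓ y ≠ x := fun e => hxy (inf_eq_left.1 e)
  have hw : x ⊔ y ≠ y := fun e => hxy (sup_eq_right.1 e)
  have h1 := hx1 (x ⊓ y) (hinf x hx y hy) hu
  have h2 := hy2 (x ⊔ y) (hsup x hx y hy) hw
  have hSm := hS x hx y hy
  have hAm := hA x hx y hy
  have hD : 0 ≤ S (x ⊔ y) - S y := by
    have := hmono y hy (x ⊔ y) (hsup x hx y hy) le_sup_right
    linarith
  have key := mul_le_mul_of_nonneg_right hθ hD
  rw [mul_sub, mul_sub] at key
  have e1 : θ₁ * S (x ⊓ y) + θ₁ * S (x ⊔ y) = θ₁ * S x + θ₁ * S y := by rw [← mul_add, ← mul_add, hSm]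
  linarith

/-- **Counting form.**  Under the hypotheses of `Lattice.le_of_unique_max`, if every member of a finite set `D ⊆ F` is the
unique maximiser over `F` at some slope `θ x`, and `ρ : α → ℕ` is strictly isotone on `F` with `ρ ≤ H` on `F`, then
`|D| ≤ H + 1` (the members of `D` are pairwise comparable, so `ρ` is injective on `D`). [folklore] -/
theorem Lattice.card_le_of_unique_max {F : Set α}
    (hinf : ∀ x ∈ F, ∀ y ∈ F, x ⊓ y ∈ F) (hsup : ∀ x ∈ F, ∀ y ∈ F, x ⊔ y ∈ F)
    (S A : α → ℤ)
    (hS : ∀ x ∈ F, ∀ y ∈ F, S (x ⊓ y) + S (x ⊔ y) = S x + S y)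
    (hA : ∀ x ∈ F, ∀ y ∈ F, A (x ⊓ y) + A (x ⊔ y) = A x + A y)
    (hmono : ∀ x ∈ F, ∀ y ∈ F, x ≤ y → S x ≤ S y)
    (D : Finset α) (hDF : ∀ x ∈ D, x ∈ F) (θ : α → ℤ)
    (hdom : ∀ x ∈ D, ∀ z ∈ F, z ≠ x → θ x * S z - A z < θ x * S x - A x)
    (ρ : α → ℕ) (H : ℕ) (hρ : ∀ x ∈ F, ∀ y ∈ F, x ≤ y → x ≠ y → ρ x < ρ y) (hH : ∀ x ∈ F, ρ x ≤ H) :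
    D.card ≤ H + 1 := by
  classical
  have hmaps : ∀ x ∈ D, ρ x ∈ Finset.range (H + 1) := fun x hx =>
    Finset.mem_range.2 (Nat.lt_succ_of_le (hH x (hDF x hx)))
  have hinj : Set.InjOn ρ D := by
    intro x hx y hy hxy
    have hxF := hDF x (Finset.mem_coe.1 hx)
    have hyF := hDF y (Finset.mem_coe.1 hy)
    by_contra hne
    rcases le_total (θ x) (θ y) with hle | hle
    · have hxy' : x ≤ y := Lattice.le_of_unique_max hinf hsup S A hS hA hmono hle hxF hyF
        (hdom x (Finset.mem_coe.1 hx)) (hdom y (Finset.mem_coe.1 hy))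
      have := hρ x hxF y hyF hxy' hne
      omega
    · have hyx' : y ≤ x := Lattice.le_of_unique_max hinf hsup S A hS hA hmono hle hyF hxF
        (hdom y (Finset.mem_coe.1 hy)) (hdom x (Finset.mem_coe.1 hx))
      have := hρ y hyF x hxF hyx' (Ne.symm hne)
      omega
  calc D.card ≤ (Finset.range (H + 1)).card := Finset.card_le_card_of_injOn _ hmaps hinj
    _ = H + 1 := Finset.card_range _

end AbstractLattice

/-! ## 2. Registers: configurations `Fin r → Fin n`, separable (additive) weights, isotone slope tables -/

section Registers

variable {r n : ℕ}

/-- on a chain, `f (a ⊓ b) + f (a ⊔ b) = f a + f b` for every `f`. -/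
theorem apply_inf_add_apply_sup (f : Fin n → ℤ) (a b : Fin n) : f (a ⊓ b) + f (a ⊔ b) = f a + f b := by
  rcases le_total a b with h | h
  · rw [inf_eq_left.2 h, sup_eq_right.2 h]
  · rw [inf_eq_right.2 h, sup_eq_left.2 h, add_comm]

/-- **separable functions on a product of chains are modular**:
`Σ_i f i ((x ⊓ y) i) + Σ_i f i ((x ⊔ y) i) = Σ_i f i (x i) + Σ_i f i (y i)`. -/
theorem sum_inf_add_sum_sup (f : Fin r → Fin n → ℤ) (x y : Fin r → Fin n) :
    (∑ i, f i ((x ⊓ y) i)) + ∑ i, f i ((x ⊔ y) i) = (∑ i, f i (x i)) + ∑ i, f i (y i) := by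
  rw [← Finset.sum_add_distrib, ← Finset.sum_add_distrib]
  refine Finset.sum_congr rfl fun i _ => ?_
  rw [Pi.inf_apply, Pi.sup_apply]
  exact apply_inf_add_apply_sup (f i) (x i) (y i)

/-- separable functions with isotone summands are isotone. -/
theorem sum_le_sum_of_isotone (s : Fin r → Fin n → ℤ) (hs : ∀ i a b, a ≤ b → s i a ≤ s i b)
    {x y : Fin r → Fin n} (hxy : x ≤ y) : (∑ i, s i (x i)) ≤ ∑ i, s i (y i) :=
  Finset.sum_le_sum fun i _ => hs i _ _ (hxy i)

/-- the rank `x ↦ Σ_i x i` is strictly isotone on `(Fin n)^r`. -/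
theorem rank_lt_of_lt {x y : Fin r → Fin n} (hxy : x ≤ y) (hne : x ≠ y) :
    (∑ i, ((x i : Fin n) : ℕ)) < ∑ i, ((y i : Fin n) : ℕ) := by
  have hex : ∃ i ∈ (Finset.univ : Finset (Fin r)), ((x i : Fin n) : ℕ) < ((y i : Fin n) : ℕ) := by
    by_contra hcon
    push Not at hcon
    apply hne
    funext i
    exact le_antisymm (hxy i) (Fin.le_def.2 (hcon i (Finset.mem_univ i)))
  exact Finset.sum_lt_sum (fun i _ => Fin.le_def.1 (hxy i)) hex

/-- the rank is at most `r·(n−1)`. -/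
theorem rank_le (x : Fin r → Fin n) : (∑ i, ((x i : Fin n) : ℕ)) ≤ r * (n - 1) := by
  calc (∑ i, ((x i : Fin n) : ℕ)) ≤ ∑ _i : Fin r, (n - 1) :=
        Finset.sum_le_sum fun i _ => Nat.le_sub_one_of_lt (x i).isLt
    _ = r * (n - 1) := by rw [Finset.sum_const, Finset.card_univ, Fintype.card_fin, smul_eq_mul]

variable {m K : ℕ}
  (d : Fin K → ℕ) (v ε : Fin m → Fin m → Fin K → ℤ)
  (P : (Fin r → Fin n) → Prop)
  (τ : (Fin r → Fin n) → Equiv.Perm (Fin m) × (Fin m → Fin K))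
  (s A : Fin r → Fin n → ℤ)
  (hPinf : ∀ x y, P x → P y → P (x ⊓ y)) (hPsup : ∀ x y, P x → P y → P (x ⊔ y))
  (hinj : ∀ x y, P x → P y → τ x = τ y → x = y)
  (hpres : ∀ x, P x → termSign ε (τ x) ≠ 0)
  (hw : ∀ x (θ : ℤ), P x → tropWeight d v θ (τ x) = θ * (∑ i, s i (x i)) - ∑ i, A i (x i))
  (hs : ∀ i a b, a ≤ b → s i a ≤ s i b)

include hinj hpres hw in
/-- a dominant member beats every other feasible member of the family (explicit weights). -/
theorem weight_lt {x z : Fin r → Fin n} {θ : ℤ} (hx : P x) (hz : P z) (hne : z ≠ x)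
    (hdom : IsDominant d v ε θ (τ x)) :
    θ * (∑ i, s i (z i)) - (∑ i, A i (z i)) < θ * (∑ i, s i (x i)) - ∑ i, A i (x i) := by
  have h := hdom.2 (τ z) (fun e => hne (hinj z x hz hx e)) (hpres z hz)
  rwa [hw z θ hz, hw x θ hx] at h

include hPinf hPsup hinj hpres hw hs in
/-- **MONOTONE COMPARATIVE STATICS FOR ISOTONE REGISTERS.**  Two members of the family dominant at slopes `θ₁ ≤ θ₂` are
comparable: `x ≤ y` pointwise — along increasing slope no register ever moves to a smaller state. -/
theorem le_of_dominant {x y : Fin r → Fin n} {θ₁ θ₂ : ℤ} (hθ : θ₁ ≤ θ₂) (hx : P x) (hy : P y)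
    (hdx : IsDominant d v ε θ₁ (τ x)) (hdy : IsDominant d v ε θ₂ (τ y)) : x ≤ y :=
  Lattice.le_of_unique_max (F := {z | P z}) (fun a ha b hb => hPinf a b ha hb) (fun a ha b hb => hPsup a b ha hb)
    (fun z => ∑ i, s i (z i)) (fun z => ∑ i, A i (z i))
    (fun a _ b _ => sum_inf_add_sum_sup s a b) (fun a _ b _ => sum_inf_add_sum_sup A a b)
    (fun _ _ _ _ hab => sum_le_sum_of_isotone s hs hab) hθ hx hy
    (fun _ hz hne => weight_lt d v ε P τ s A hinj hpres hw hx hz hne hdx)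
    (fun _ hz hne => weight_lt d v ε P τ s A hinj hpres hw hy hz hne hdy)

open scoped Classical in
include hPinf hPsup hinj hpres hw hs in
/-- **ISOTONE REGISTERS UNDER A LATTICE CONSTRAINT ARE ADDITIVE.**  At most `r·(n − 1) + 1` feasible members of the family
are dominant (each at some integer slope, against all present terms of the design) — for every number `r` of registers and
every min/max-closed coupling `P`. -/
theorem card_dominant_le :
    ((Finset.univ : Finset (Fin r → Fin n)).filter (fun x => P x ∧ ∃ θ : ℤ, IsDominant d v ε θ (τ x))).card
      ≤ r * (n - 1) + 1 := by
  classical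
  set D := (Finset.univ : Finset (Fin r → Fin n)).filter (fun x => P x ∧ ∃ θ : ℤ, IsDominant d v ε θ (τ x)) with hD
  have hmem : ∀ x ∈ D, P x ∧ ∃ θ : ℤ, IsDominant d v ε θ (τ x) := fun x hx => (Finset.mem_filter.1 hx).2
  choose! θ hθ using fun x (hx : x ∈ D) => (hmem x hx).2
  exact Lattice.card_le_of_unique_max (F := {z | P z}) (fun a ha b hb => hPinf a b ha hb)
    (fun a ha b hb => hPsup a b ha hb) (fun z => ∑ i, s i (z i)) (fun z => ∑ i, A i (z i))
    (fun a _ b _ => sum_inf_add_sum_sup s a b) (fun a _ b _ => sum_inf_add_sum_sup A a b)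
    (fun _ _ _ _ hab => sum_le_sum_of_isotone s hs hab) D (fun x hx => (hmem x hx).1) θ
    (fun x hx _ hz hne => weight_lt d v ε P τ s A hinj hpres hw (hmem x hx).1 hz hne (hθ x hx))
    (fun z => ∑ i, ((z i : Fin n) : ℕ)) (r * (n - 1)) (fun _ _ _ _ hab hne => rank_lt_of_lt hab hne)
    (fun a _ => rank_le a)

end Registers

/-! ## 3. Two lattice couplings: comparability chains of any length, and difference-constraint systems -/

section Couplings

variable {r n : ℕ}

/-- the pointwise `min` of two strictly increasing configurations is strictly increasing. -/
theorem strictMono_inf_closed (x y : Fin r → Fin n) (hx : StrictMono x) (hy : StrictMono y) : StrictMono (x ⊓ y) := by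
  intro i j hij
  rw [Pi.inf_apply, Pi.inf_apply]
  exact lt_inf_iff.2 ⟨inf_lt_of_left_lt (hx hij), inf_lt_of_right_lt (hy hij)⟩

/-- the pointwise `max` of two strictly increasing configurations is strictly increasing. -/
theorem strictMono_sup_closed (x y : Fin r → Fin n) (hx : StrictMono x) (hy : StrictMono y) : StrictMono (x ⊔ y) := by
  intro i j hij
  rw [Pi.sup_apply, Pi.sup_apply]
  exact sup_lt_iff.2 ⟨lt_sup_of_lt_left (hx hij), lt_sup_of_lt_right (hy hij)⟩

/-- difference constraints `x j − x i ≤ c i j` are closed under pointwise `min`. -/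
theorem diff_inf_closed (c : Fin r → Fin r → ℤ) (x y : Fin r → Fin n)
    (hx : ∀ i j, ((x j : Fin n) : ℤ) - (x i : Fin n) ≤ c i j) (hy : ∀ i j, ((y j : Fin n) : ℤ) - (y i : Fin n) ≤ c i j) :
    ∀ i j, (((x ⊓ y) j : Fin n) : ℤ) - ((x ⊓ y) i : Fin n) ≤ c i j := by
  intro i j
  rw [Pi.inf_apply, Pi.inf_apply]
  have h1 := hx i j
  have h2 := hy i j
  rcases le_total (x i) (y i) with hi | hi <;> rcases le_total (x j) (y j) with hj | hj
  · rw [inf_eq_left.2 hi, inf_eq_left.2 hj]; exact h1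
  · rw [inf_eq_left.2 hi, inf_eq_right.2 hj]
    have : ((y j : Fin n) : ℤ) ≤ (x j : Fin n) := by exact_mod_cast Fin.le_def.1 hj
    linarith
  · rw [inf_eq_right.2 hi, inf_eq_left.2 hj]
    have : ((x j : Fin n) : ℤ) ≤ (y j : Fin n) := by exact_mod_cast Fin.le_def.1 hj
    linarith
  · rw [inf_eq_right.2 hi, inf_eq_right.2 hj]; exact h2

/-- difference constraints `x j − x i ≤ c i j` are closed under pointwise `max`. -/
theorem diff_sup_closed (c : Fin r → Fin r → ℤ) (x y : Fin r → Fin n)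
    (hx : ∀ i j, ((x j : Fin n) : ℤ) - (x i : Fin n) ≤ c i j) (hy : ∀ i j, ((y j : Fin n) : ℤ) - (y i : Fin n) ≤ c i j) :
    ∀ i j, (((x ⊔ y) j : Fin n) : ℤ) - ((x ⊔ y) i : Fin n) ≤ c i j := by
  intro i j
  rw [Pi.sup_apply, Pi.sup_apply]
  have h1 := hx i j
  have h2 := hy i j
  rcases le_total (x i) (y i) with hi | hi <;> rcases le_total (x j) (y j) with hj | hj
  · rw [sup_eq_right.2 hi, sup_eq_right.2 hj]; exact h2
  · rw [sup_eq_right.2 hi, sup_eq_left.2 hj]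
    have : ((x i : Fin n) : ℤ) ≤ (y i : Fin n) := by exact_mod_cast Fin.le_def.1 hi
    linarith
  · rw [sup_eq_left.2 hi, sup_eq_right.2 hj]
    have : ((y i : Fin n) : ℤ) ≤ (x i : Fin n) := by exact_mod_cast Fin.le_def.1 hi
    linarith
  · rw [sup_eq_left.2 hi, sup_eq_left.2 hj]; exact h1

variable {m K : ℕ}
  (d : Fin K → ℕ) (v ε : Fin m → Fin m → Fin K → ℤ)
  (τ : (Fin r → Fin n) → Equiv.Perm (Fin m) × (Fin m → Fin K))
  (s A : Fin r → Fin n → ℤ)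
  (hs : ∀ i a b, a ≤ b → s i a ≤ s i b)

open scoped Classical in
include hs in
/-- **COMPARABILITY CHAINS OF ISOTONE REGISTERS ARE ADDITIVE, FOR EVERY LENGTH.**  `r` registers with positions in a common
window `Fin n`, feasible iff the positions strictly increase (`x 0 < x 1 < ⋯`), terms present and pairwise distinct on the
feasible configurations, additive weights with isotone slope tables: at most `r·(n − 1) + 1` dominant members.  (Without
isotonicity this family is the parametric shortest-path problem of the `(r+1) × (n−r+1)` directed grid, which has
`n^{Ω(log n)}` breakpoints for suitable lines when `r ≍ n/2` [Gajjar–Radhakrishnan 2018, Cor. 3]; see the module docstring.) -/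
theorem card_dominant_le_of_strictMono
    (hinj : ∀ x y, StrictMono x → StrictMono y → τ x = τ y → x = y)
    (hpres : ∀ x, StrictMono x → termSign ε (τ x) ≠ 0)
    (hw : ∀ x (θ : ℤ), StrictMono x → tropWeight d v θ (τ x) = θ * (∑ i, s i (x i)) - ∑ i, A i (x i)) :
    ((Finset.univ : Finset (Fin r → Fin n)).filter (fun x => StrictMono x ∧ ∃ θ : ℤ, IsDominant d v ε θ (τ x))).card
      ≤ r * (n - 1) + 1 := by
  convert card_dominant_le d v ε (fun x => StrictMono x) τ s A (fun x y hx hy => strictMono_inf_closed x y hx hy)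
    (fun x y hx hy => strictMono_sup_closed x y hx hy) hinj hpres hw hs using 3

open scoped Classical in
include hs in
/-- **DIFFERENCE-CONSTRAINED ISOTONE REGISTERS ARE ADDITIVE.**  `r` registers with states `Fin n`, feasible iff
`x j − x i ≤ c i j` for all `i, j` (an arbitrary integer table `c`; windows, bands, comparabilities, crowns …), terms present
and pairwise distinct on the feasible configurations, additive weights with isotone slope tables: at most `r·(n − 1) + 1`
dominant members. -/
theorem card_dominant_le_of_diff (c : Fin r → Fin r → ℤ)
    (hinj : ∀ x y, (∀ i j, ((x j : Fin n) : ℤ) - (x i : Fin n) ≤ c i j) →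
      (∀ i j, ((y j : Fin n) : ℤ) - (y i : Fin n) ≤ c i j) → τ x = τ y → x = y)
    (hpres : ∀ x, (∀ i j, ((x j : Fin n) : ℤ) - (x i : Fin n) ≤ c i j) → termSign ε (τ x) ≠ 0)
    (hw : ∀ x (θ : ℤ), (∀ i j, ((x j : Fin n) : ℤ) - (x i : Fin n) ≤ c i j) →
      tropWeight d v θ (τ x) = θ * (∑ i, s i (x i)) - ∑ i, A i (x i)) :
    ((Finset.univ : Finset (Fin r → Fin n)).filter (fun x =>
        (∀ i j, ((x j : Fin n) : ℤ) - (x i : Fin n) ≤ c i j) ∧ ∃ θ : ℤ, IsDominant d v ε θ (τ x))).card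
      ≤ r * (n - 1) + 1 := by
  convert card_dominant_le d v ε (fun x => ∀ i j, ((x j : Fin n) : ℤ) - (x i : Fin n) ≤ c i j) τ s A
    (fun x y hx hy => diff_inf_closed c x y hx hy) (fun x y hx hy => diff_sup_closed c x y hx hy) hinj hpres hw hs
    using 3

end Couplings

end Summit.ValiantsHypothesis.ValiantsHypothesis.Theorems.KPlusLogSqLaw.IsotoneRegisters
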